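import Summits.Ventures.Crystal3D.Theorems.StickyWulffConstantPolycrystalWulffBoundTwinCapsChimera
import Summits.Ventures.Crystal3D.Theorems.StickyWulffConstantPolycrystalWulffBoundCapHeight
import Summits.Ventures.Crystal3D.Theorems.StickyWulffConstantPolycrystalWulffBoundTwinTreeWeights

/-!
# `PolycrystalWulffBound`, rung `rung_twinTree` — the CHIMERA lower bound for a basal-joined TWIN TREE
# (nested secondary twins about different axes; line `PolyDensity`, crux `stmt-Ventures-19482`)

Route `StickyWulffConstant` of the venture `Summits/Ventures/Crystal3D`, second prover lane (poly-p2,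
gen 12).  The most general zero-budget texture the sorted piecewise Brunn–Minkowski engine
(`piecewise_chimera_lower`) handles: grains `G f`, `f : Fin (N+1)`, organised as a TREE with root `0` —
node `i.succ` has the parent `par i` (`par i ≤ i`), an axis `m i`, a threshold `t i`, lies above the plane
(`G i.succ ⊆ {t i < ⟪x, m i⟫}`) and carries a frame co-axial with its parent's ABOUT ITS OWN AXIS (the
self-clauses of `A (par i)` and `A i.succ` about `m i`; e.g. a twin of a twin about a second `⟨111⟩`
axis); the parent's points `δ`-near the child lie below the plane (localized clause); NON-ADJACENT nodes
are `δ`-separated.  Every wall is a coherent basal twin plane of SOME pair — budget zero.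
Targets: node `f` ↦ `W(A f) ∩ {own cap: s j < ⟪y, m j⟫ (f = j.succ)} ∩ ⋂_{children i} {⟪y, m i⟫ ≤ s i}`
with `s i` the exact cap height of fraction `u i.succ` = SUBTREE weight (`exists_subtreeWeights`,
`exists_capHeight_eq`); its volume is `≥ 32(u f − Σ_children u) = 32σ_f`.  Regions: own window
`{t j + r s j < ⟪y,m j⟫}`, «below `t i + r s i` wherever `r(√5+1)`-near child `i`», and the
`r(√5+1)`-thickening of the node.  Conclusion (`twinTree_chimera_lower`):
`|⋃ G f|^{1/3} + r·32^{1/3} ≤ |U|^{1/3}` for `U ⊇` the chimera neighbourhood, `0 < r`, `2(√5+1)r ≤ δ`.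
WHAT THIS IS NOT: the rung (`…RungTwinTree.lean`); nodes touching a non-parent ancestor, or two
children of one node touching each other, are charged-wall situations and not covered; the crux is not
claimed.
-/

noncomputable section

open scoped BigOperators InnerProductSpace ENNReal Pointwise
open MeasureTheory Set

namespace Summit.Ventures.Crystal3D.Theorems

open Summit.Ventures.Crystal3D.Cruxes.TextureLiminf.TexShadow (E3)
open Literature.MathematicalPhysics.StatisticalMechanics (fccStacking barlowStacking IsHaggSeq)

/-- **Chimera lower bound for a basal-joined twin tree** (see the module docstring). -/
theorem twinTree_chimera_lower {N : ℕ} (par : Fin N → Fin (N + 1)) (hpar : ∀ i, (par i : ℕ) ≤ i)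
    (m : Fin N → E3) (t : Fin N → ℝ) (A : Fin (N + 1) → (E3 ≃ₗᵢ[ℝ] E3))
    (hAp : ∀ i, ∃ (L : E3 ≃ₗᵢ[ℝ] E3) (s₁ s₂ : E3) (σ σ' : ℤ → ℤ), IsHaggSeq σ ∧ IsHaggSeq σ' ∧
      L (EuclideanSpace.single (2 : Fin 3) (1 : ℝ)) = m i ∧
      A (par i) '' fccStacking 1 (Real.sqrt (2 / 3)) ⊆
        (fun q => L q + s₁) '' barlowStacking 1 (Real.sqrt (2 / 3)) σ ∧
      A (par i) '' fccStacking 1 (Real.sqrt (2 / 3)) ⊆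
        (fun q => L q + s₂) '' barlowStacking 1 (Real.sqrt (2 / 3)) σ')
    (hAc : ∀ i, ∃ (L : E3 ≃ₗᵢ[ℝ] E3) (s₁ s₂ : E3) (σ σ' : ℤ → ℤ), IsHaggSeq σ ∧ IsHaggSeq σ' ∧
      L (EuclideanSpace.single (2 : Fin 3) (1 : ℝ)) = m i ∧
      A i.succ '' fccStacking 1 (Real.sqrt (2 / 3)) ⊆
        (fun q => L q + s₁) '' barlowStacking 1 (Real.sqrt (2 / 3)) σ ∧
      A i.succ '' fccStacking 1 (Real.sqrt (2 / 3)) ⊆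
        (fun q => L q + s₂) '' barlowStacking 1 (Real.sqrt (2 / 3)) σ')
    (G : Fin (N + 1) → Set E3) (hGo : ∀ f, IsOpen (G f))
    (hGt : ∀ i, ∀ x ∈ G i.succ, t i < ⟪x, m i⟫_ℝ) {δ : ℝ} (hδ : 0 < δ)
    (hPt : ∀ i, ∀ x ∈ G (par i), ⟪x, m i⟫_ℝ < t i ∨ ∀ y ∈ G i.succ, δ ≤ dist x y)
    (hsep : ∀ f g : Fin (N + 1), f ≠ g → (∀ i, ¬ (f = par i ∧ g = i.succ)) →
      (∀ i, ¬ (g = par i ∧ f = i.succ)) → ∀ x ∈ G f, ∀ y ∈ G g, δ ≤ dist x y)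
    (h0 : volume (⋃ f, G f) ≠ 0) (htop : volume (⋃ f, G f) ≠ ⊤)
    {r : ℝ} (hr : 0 < r) (hrδ : r * (2 * (Real.sqrt 5 + 1)) ≤ δ) {U : Set E3}
    (hsub : ∀ f, ∀ x ∈ G f, ∀ w ∈ {y : E3 | ∀ ν : E3, ⟪y, ν⟫_ℝ ≤ Real.sqrt 2 / 4 *
        ∑ᶠ w ∈ {w | w ∈ fccStacking 1 (Real.sqrt (2 / 3)) ∧ ‖w‖ = 1}, |⟪w, (A f).symm ν⟫_ℝ|},
      x + r • w ∈ U) :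
    volume (⋃ f, G f) ^ ((3 : ℕ)⁻¹ : ℝ) +
        ENNReal.ofReal r * (ENNReal.ofReal 32) ^ ((3 : ℕ)⁻¹ : ℝ) ≤ volume U ^ ((3 : ℕ)⁻¹ : ℝ) := by
  classical
  -- the bodies
  set body : (E3 ≃ₗᵢ[ℝ] E3) → Set E3 := fun X => {y : E3 | ∀ ν : E3, ⟪y, ν⟫_ℝ ≤ Real.sqrt 2 / 4 *
    ∑ᶠ w ∈ {w | w ∈ fccStacking 1 (Real.sqrt (2 / 3)) ∧ ‖w‖ = 1}, |⟪w, X.symm ν⟫_ℝ|} with hbody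
  have hWc : ∀ X, IsCompact (body X) := fun X => isCompact_cruxWulffBody X
  have hWm : ∀ X, MeasurableSet (body X) := fun X => (hWc X).isClosed.measurableSet
  have hWball : ∀ X, body X ⊆ Metric.closedBall (0 : E3) (Real.sqrt 5) :=
    fun X => cruxWulffBody_subset_closedBall X
  have hWvol : ∀ X, volume (body X) = ENNReal.ofReal 32 := fun X => volume_cruxWulffBody X
  have hm1 : ∀ i, ‖m i‖ = 1 := by
    intro i
    obtain ⟨L', -, -, -, -, -, -, hLm, -, -⟩ := hAp i
    rw [← hLm, LinearIsometryEquiv.norm_map]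
    simp
  have h51 : 0 < 2 * (Real.sqrt 5 + 1) := by positivity
  -- disjointness of the grains
  have hadj : ∀ i, Disjoint (G (par i)) (G i.succ) := by
    intro i
    rw [Set.disjoint_left]
    intro x hxp hxc
    rcases hPt i x hxp with h | h
    · exact lt_irrefl _ (h.trans (hGt i x hxc))
    · have h' := h x hxc
      rw [dist_self] at h'
      exact absurd h' (not_le.2 hδ)
  have hdisjG : Pairwise fun f g => Disjoint (G f) (G g) := by
    intro f g hfg
    by_cases h1 : ∃ i, f = par i ∧ g = i.succ
    · obtain ⟨i, rfl, rfl⟩ := h1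
      exact hadj i
    by_cases h2 : ∃ i, g = par i ∧ f = i.succ
    · obtain ⟨i, rfl, rfl⟩ := h2
      exact (hadj i).symm
    simp only [not_exists] at h1 h2
    exact Set.disjoint_left.2 fun x hx hx' => by
      have h := hsep f g hfg h1 h2 x hx x hx'
      rw [dist_self] at h
      exact absurd h (not_le.2 hδ)
  -- volumes, fractions, subtree weights
  set V : ℝ≥0∞ := volume (⋃ f, G f) with hV
  have hGm : ∀ f, MeasurableSet (G f) := fun f => (hGo f).measurableSet
  have hVsum : V = ∑ f, volume (G f) := by
    rw [hV, measure_iUnion (fun f g h => hdisjG h) hGm, tsum_fintype]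
  have hGfin : ∀ f, volume (G f) ≠ ⊤ := fun f =>
    (lt_of_le_of_lt (measure_mono (subset_iUnion G f)) htop.lt_top).ne
  set Vr : ℝ := V.toReal with hVr
  set σ : Fin (N + 1) → ℝ := fun f => (volume (G f)).toReal / Vr with hσ
  have hVr0 : 0 < Vr := ENNReal.toReal_pos h0 htop
  have hσ0 : ∀ f, 0 ≤ σ f := fun f => div_nonneg ENNReal.toReal_nonneg hVr0.le
  have hσ1 : ∑ f, σ f = 1 := by
    simp only [hσ]
    rw [← Finset.sum_div, ← ENNReal.toReal_sum (fun f _ => hGfin f), ← hVsum, div_self hVr0.ne']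
  obtain ⟨u, hrec, hu0, hu1, hroot⟩ := exists_subtreeWeights par hpar σ hσ0 hσ1
  -- exact cap heights of the children, in the parent's body and in the child's body
  have hs : ∀ i, ∃ s : ℝ, |s| ≤ Real.sqrt 5 + 1 ∧
      volume (body (A (par i)) ∩ {y : E3 | s < ⟪y, m i⟫_ℝ}) = ENNReal.ofReal (32 * u i.succ) :=
    fun i => exists_capHeight_eq (A (par i)) (m i) (hm1 i) (hu0 _) (hu1 _)
  choose s hsR hsP using hs
  have hsC : ∀ i, volume (body (A i.succ) ∩ {y : E3 | s i < ⟪y, m i⟫_ℝ}) =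
      ENNReal.ofReal (32 * u i.succ) := by
    intro i
    have h := volume_cruxWulffBody_inter_eq_of_coaxial (hAp i) (hAc i) (s i)
    show volume (body (A i.succ) ∩ {y : E3 | s i < ⟪y, m i⟫_ℝ}) = ENNReal.ofReal (32 * u i.succ)
    simp only [hbody]
    rw [h]
    exact hsP i
  -- the targets
  set T : Fin (N + 1) → Set E3 := fun f => body (A f) ∩
    ((⋂ i ∈ Finset.univ.filter (fun i => par i = f), {y : E3 | ⟪y, m i⟫_ℝ ≤ s i}) ∩
      ⋂ j ∈ Finset.univ.filter (fun j : Fin N => f = j.succ), {y : E3 | s j < ⟪y, m j⟫_ℝ}) with hT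
  have hgt_m : ∀ i (c : ℝ), MeasurableSet {y : E3 | c < ⟪y, m i⟫_ℝ} := fun i c =>
    measurableSet_lt measurable_const (measurable_id.inner measurable_const)
  have hle_m : ∀ i (c : ℝ), MeasurableSet {y : E3 | ⟪y, m i⟫_ℝ ≤ c} := fun i c =>
    measurableSet_le (measurable_id.inner measurable_const) measurable_const
  have hTm : ∀ f, MeasurableSet (T f) := fun f =>
    (hWm (A f)).inter ((Finset.measurableSet_biInter _ fun i _ => hle_m i _).inter
      (Finset.measurableSet_biInter _ fun j _ => hgt_m j _))
  -- membership in the two constraint sets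
  have hmemC : ∀ f (y : E3), y ∈ (⋂ i ∈ Finset.univ.filter (fun i => par i = f),
      {y : E3 | ⟪y, m i⟫_ℝ ≤ s i}) ↔ ∀ i, par i = f → ⟪y, m i⟫_ℝ ≤ s i := by
    intro f y
    simp only [mem_iInter, Finset.mem_filter, Finset.mem_univ, true_and, mem_setOf_eq]
  have hmemO : ∀ f (y : E3), y ∈ (⋂ j ∈ Finset.univ.filter (fun j : Fin N => f = j.succ),
      {y : E3 | s j < ⟪y, m j⟫_ℝ}) ↔ ∀ j : Fin N, f = j.succ → s j < ⟪y, m j⟫_ℝ := by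
    intro f y
    simp only [mem_iInter, Finset.mem_filter, Finset.mem_univ, true_and, mem_setOf_eq]
  -- target volumes: own cap (volume `32·u f`) minus the children's caps
  have hTvol : ∀ f, ENNReal.ofReal (32 * σ f) ≤ volume (T f) := by
    intro f
    -- the own cap
    set Own : Set E3 := body (A f) ∩ ⋂ j ∈ Finset.univ.filter (fun j : Fin N => f = j.succ),
      {y : E3 | s j < ⟪y, m j⟫_ℝ} with hOwn
    have hOwnvol : volume Own = ENNReal.ofReal (32 * u f) := by
      induction f using Fin.cases with
      | zero =>
        have : Own = body (A 0) := by
          rw [hOwn]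
          refine inter_eq_left.2 fun y _ => (hmemO 0 y).2 fun j hj => absurd hj (Fin.succ_ne_zero j).symm
        rw [this, hWvol, hroot, mul_one]
      | succ j₀ =>
        have : Own = body (A j₀.succ) ∩ {y : E3 | s j₀ < ⟪y, m j₀⟫_ℝ} := by
          rw [hOwn]
          ext y
          simp only [mem_inter_iff, hmemO]
          constructor
          · rintro ⟨hy, h⟩; exact ⟨hy, h j₀ rfl⟩
          · rintro ⟨hy, h⟩
            refine ⟨hy, fun j hj => ?_⟩
            have hjj : j₀ = j := Fin.succ_inj.1 hj
            subst hjj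
            exact h
        rw [this, hsC j₀]
    have hcov : Own ⊆ T f ∪ ⋃ i ∈ Finset.univ.filter (fun i => par i = f),
        (body (A f) ∩ {y : E3 | s i < ⟪y, m i⟫_ℝ}) := by
      rintro y ⟨hy, hyo⟩
      by_cases h : ∀ i, par i = f → ⟪y, m i⟫_ℝ ≤ s i
      · exact Or.inl ⟨hy, (hmemC f y).2 h, hyo⟩
      · simp only [not_forall, not_le] at h
        obtain ⟨i, hi, hlt⟩ := h
        exact Or.inr (mem_iUnion₂.2 ⟨i, Finset.mem_filter.2 ⟨Finset.mem_univ _, hi⟩, hy, hlt⟩)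
    have hchildvol : ∀ i ∈ Finset.univ.filter (fun i => par i = f),
        volume (body (A f) ∩ {y : E3 | s i < ⟪y, m i⟫_ℝ}) = ENNReal.ofReal (32 * u i.succ) := by
      intro i hi
      rw [Finset.mem_filter] at hi
      rw [← hi.2]
      exact hsP i
    have h1 : ENNReal.ofReal (32 * u f) ≤ volume (T f) +
        ∑ i ∈ Finset.univ.filter (fun i => par i = f), ENNReal.ofReal (32 * u i.succ) := by
      rw [← hOwnvol, ← Finset.sum_congr rfl hchildvol]
      exact (measure_mono hcov).trans ((measure_union_le _ _).trans
        (add_le_add le_rfl (measure_biUnion_finset_le _ _)))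
    rw [hrec f, mul_add, Finset.mul_sum, ENNReal.ofReal_add (mul_nonneg (by norm_num) (hσ0 f))
      (Finset.sum_nonneg fun i _ => mul_nonneg (by norm_num) (hu0 _)),
      ENNReal.ofReal_sum_of_nonneg (fun i _ => mul_nonneg (by norm_num) (hu0 _))] at h1
    exact (ENNReal.add_le_add_iff_right (ENNReal.sum_ne_top.2 fun i _ => ENNReal.ofReal_ne_top)).1 h1
  -- the regions
  set ρ : ℝ := r * (Real.sqrt 5 + 1) with hρ
  have hρ0 : 0 < ρ := by positivity
  set a : Fin N → ℝ := fun i => t i + r * s i with ha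
  set R : Fin (N + 1) → Set E3 := fun f =>
    ((⋂ i ∈ Finset.univ.filter (fun i => par i = f),
        ((Metric.thickening ρ (G i.succ))ᶜ ∪ {y : E3 | ⟪y, m i⟫_ℝ < a i})) ∩
      ⋂ j ∈ Finset.univ.filter (fun j : Fin N => f = j.succ), {y : E3 | a j < ⟪y, m j⟫_ℝ}) ∩
    Metric.thickening ρ (G f) with hR
  have hmemRC : ∀ f (y : E3), y ∈ (⋂ i ∈ Finset.univ.filter (fun i => par i = f),
      ((Metric.thickening ρ (G i.succ))ᶜ ∪ {y : E3 | ⟪y, m i⟫_ℝ < a i})) ↔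
      ∀ i, par i = f → y ∈ Metric.thickening ρ (G i.succ) → ⟪y, m i⟫_ℝ < a i := by
    intro f y
    simp only [mem_iInter, Finset.mem_filter, Finset.mem_univ, true_and, mem_union, mem_compl_iff,
      mem_setOf_eq]
    exact forall_congr' fun i => forall_congr' fun _ => ⟨fun h hy => h.resolve_left (fun hn => hn hy),
      fun h => (em (y ∈ Metric.thickening ρ (G i.succ))).elim (fun hy => Or.inr (h hy)) Or.inl⟩
  have hmemRO : ∀ f (y : E3), y ∈ (⋂ j ∈ Finset.univ.filter (fun j : Fin N => f = j.succ),
      {y : E3 | a j < ⟪y, m j⟫_ℝ}) ↔ ∀ j : Fin N, f = j.succ → a j < ⟪y, m j⟫_ℝ := by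
    intro f y
    simp only [mem_iInter, Finset.mem_filter, Finset.mem_univ, true_and, mem_setOf_eq]
  -- disjointness of the regions
  have hthick : ∀ f g : Fin (N + 1), (∀ x ∈ G f, ∀ y ∈ G g, δ ≤ dist x y) →
      Disjoint (Metric.thickening ρ (G f)) (Metric.thickening ρ (G g)) := by
    intro f g hfg
    rw [Set.disjoint_left]
    intro y hyf hyg
    obtain ⟨x, hx, hdx⟩ := Metric.mem_thickening_iff.1 hyf
    obtain ⟨x', hx', hdx'⟩ := Metric.mem_thickening_iff.1 hyg
    have h1 : δ ≤ dist x x' := hfg x hx x' hx'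
    have h2 : dist x x' < ρ + ρ := (dist_triangle x y x').trans_lt (by
      rw [dist_comm x y]; exact add_lt_add hdx hdx')
    have h3 : 2 * ρ ≤ δ := by rw [hρ]; linarith
    linarith
  have hRadj : ∀ i, Disjoint (U ∩ R (par i)) (U ∩ R i.succ) := by
    intro i
    rw [Set.disjoint_left]
    rintro y ⟨-, ⟨hyc, -⟩, -⟩ ⟨-, ⟨-, hyo⟩, hyt⟩
    have h1 : ⟪y, m i⟫_ℝ < a i := (hmemRC _ y).1 hyc i rfl hyt
    have h2 : a i < ⟪y, m i⟫_ℝ := (hmemRO _ y).1 hyo i rfl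
    exact lt_irrefl _ (h1.trans h2)
  have hdisjR : Pairwise fun f g => Disjoint (U ∩ R f) (U ∩ R g) := by
    intro f g hfg
    by_cases h1 : ∃ i, f = par i ∧ g = i.succ
    · obtain ⟨i, rfl, rfl⟩ := h1
      exact hRadj i
    by_cases h2 : ∃ i, g = par i ∧ f = i.succ
    · obtain ⟨i, rfl, rfl⟩ := h2
      exact (hRadj i).symm
    simp only [not_exists] at h1 h2
    exact (hthick f g (hsep f g hfg h1 h2)).mono (fun y hy => hy.2.2) (fun y hy => hy.2.2)
  -- the swollen pieces lie in `U` and in their regions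
  have hinc : ∀ f, G f + r • T f ⊆ U ∩ R f := by
    intro f
    rintro z ⟨x, hx, y, hy, rfl⟩
    obtain ⟨p, hp, rfl⟩ := Set.mem_smul_set.1 hy
    have hp5 : ‖p‖ ≤ Real.sqrt 5 := mem_closedBall_zero_iff.1 (hWball (A f) hp.1)
    have h1 : ∀ i, ⟪x + r • p, m i⟫_ℝ = ⟪x, m i⟫_ℝ + r * ⟪p, m i⟫_ℝ := fun i => by
      rw [inner_add_left, inner_smul_left]; simp
    refine ⟨hsub f x hx p hp.1, ⟨(hmemRC f _).2 fun i hi hz => ?_, (hmemRO f _).2 fun j hj => ?_⟩, ?_⟩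
    · -- near child `i`: the parent point lies below the child's plane
      obtain ⟨y, hyL, hdy⟩ := Metric.mem_thickening_iff.1 hz
      have hdist : dist x y < δ :=
        calc dist x y ≤ dist x (x + r • p) + dist (x + r • p) y := dist_triangle _ _ _
          _ = r * ‖p‖ + dist (x + r • p) y := by
              rw [dist_eq_norm, sub_add_cancel_left, norm_neg, norm_smul, Real.norm_of_nonneg hr.le]
          _ < r * Real.sqrt 5 + ρ := add_lt_add_of_le_of_lt (by gcongr) hdy
          _ ≤ δ := by rw [hρ]; nlinarith
      have hxG : x ∈ G (par i) := by rw [hi]; exact hx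
      have hxt : ⟪x, m i⟫_ℝ < t i := by
        rcases hPt i x hxG with h | h
        · exact h
        · exact absurd (h y hyL) (not_le.2 hdist)
      have hpi : ⟪p, m i⟫_ℝ ≤ s i := (hmemC f p).1 hp.2.1 i hi
      show ⟪x + r • p, m i⟫_ℝ < t i + r * s i
      rw [h1]
      have h2 : r * ⟪p, m i⟫_ℝ ≤ r * s i := mul_le_mul_of_nonneg_left hpi hr.le
      linarith
    · -- own window
      have hxG : x ∈ G j.succ := by rw [← hj]; exact hx
      have hxt : t j < ⟪x, m j⟫_ℝ := hGt j x hxG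
      have hpj : s j < ⟪p, m j⟫_ℝ := (hmemO f p).1 hp.2.2 j hj
      show t j + r * s j < ⟪x + r • p, m j⟫_ℝ
      rw [h1]
      have h2 : r * s j < r * ⟪p, m j⟫_ℝ := mul_lt_mul_of_pos_left hpj hr
      linarith
    · rw [Metric.mem_thickening_iff]
      refine ⟨x, hx, ?_⟩
      rw [dist_eq_norm, add_sub_cancel_left, norm_smul, Real.norm_of_nonneg hr.le, hρ]
      calc r * ‖p‖ ≤ r * Real.sqrt 5 := by gcongr
        _ < r * (Real.sqrt 5 + 1) := by nlinarith
  have hdisj : Pairwise fun f g => Disjoint (G f + r • T f) (G g + r • T g) :=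
    fun f g hfg => (hdisjR hfg).mono (hinc f) (hinc g)
  exact piecewise_chimera_lower G T (by norm_num : (0:ℝ) < 32) hGo hTm hdisjG h0 htop hr hTvol hdisj
    (fun f => (hinc f).trans inter_subset_left)

end Summit.Ventures.Crystal3D.Theorems

end
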